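import Literature.Computability.QuantumComplexity.PhaseQueryLayout
import Literature.Computability.QuantumComplexity.CWrapFamily
import HarnessLib

/-!
# Phase-query families, III: the specification of the phase machine and the classical semantics

Third file of the construction (`PhaseQueryOps.lean`, `PhaseQueryLayout.lean`). Here:

* `dword`: the content of the data wires as the phase machine sees it — input `x`, the three query
  registers, the unary layer register `1^j 0^{Ly-j}`, the copy code, the mode — and `Spec P`: the
  **semantic specification** of the mode-multiplexed function `P.Fn` (the number `Wv x` of active
  query wires, the number `Kv x` of active Hadamard layers, the phase predicate `Pf x q j`, the zero
  test), stated as equations about `P.Fn (dword … ++ vg N)`;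
* `cleanW F top`: the assignments met during the computation — a data function `F` below `D`, a clear
  work area, the wires above the block given by `top` — and **the block lemma** `clEval_blkC_cleanW`
  (the clean block writes the read-out of `P.Fn (data ++ vg N)` on its result wires and touches
  nothing else: `RevClean.clEval_cleanOps` framed by `RevUncompute.clEval_ite`), with its value on the
  emptiness wires (`clEval_blkC_cleanW_eW`: `[|out| ≤ j]`, `CWrapLayout.outBit_none_eq`);
* the **mask stage**: `clEval (preC P N) (strW x) = cleanW (dfun x 0 0 0 ff ff) (topPre x)` — the
  masks read `[t < Wv x]` and `[j < Kv x]`, everything else is as at the start (`clEval_preC`);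
* the **phase macro, classically**: its opening and closing compose to the identity
  (`clEval_pOpen_pClose`, from the involutions), and after the opening the emptiness wire of cell `0`
  holds the phase bit (`clEval_pOpen_eW`);
* the **zero test**: wire `0` after `postC` holds `[some query register is zero]` (`clEval_postC_zero`).

## References

* S. Aaronson, A. Ambainis, *Forrelation*, SIAM J. Comput. 47 (2018), §6 (p. 26) [AaronsonAmbainis2018].
* M. A. Nielsen, I. L. Chuang, *Quantum Computation and Quantum Information*, CUP 2010, §3.2.5,
  §6.1.1 [NielsenChuang2010].
* E. Bernstein, U. Vazirani, *Quantum complexity theory*, SIAM J. Comput. 26 (1997), §8 [BernsteinVazirani1997].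
-/

noncomputable section

namespace Literature.Computability.QuantumComplexity

open _root_.Computability Complexity Cryptography Matrix Finset RevSim RevClean RazTalMachine Turing

namespace PhaseQuery

variable (P : Params)

/-! ### Data words and the specification -/

section Spec

/-- Zeros. [folklore] -/
abbrev zeros (k : ℕ) : List Bool := List.replicate k false

/-- The unary word `1^j 0^{L-j}` of the layer register. [folklore] -/
def junary (L j : ℕ) : List Bool := List.replicate j true ++ List.replicate (L - j) false

/-- The two-bit code of copy `c`: `0 ↦ 00`, `1 ↦ 10`, `2 ↦ 01`. [folklore] -/
def ccode (c : ℕ) : List Bool := [decide (c = 1), decide (c = 2)]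

/-- **The data word** seen by the phase machine: input, the three query registers, the layer
register, the copy code, the mode bits. [folklore] -/
def dword (x : List Bool) (q : ℕ → List Bool) (jv cv mv : List Bool) : List Bool :=
  x ++ (q 0 ++ (q 1 ++ (q 2 ++ (jv ++ (cv ++ mv)))))

/-- **Specification of the phase machine** of the parameters `P`: the semantic functions read off
`P.Fn` in the four modes. `Wv x`: active query wires; `Kv x`: active Hadamard layers; `Pf x u j`: the
phase bit of layer `j` on register content `u`; and the zero test. All data words have the query
registers of length `Wq`, the layer register of length `Ly`. [cite: AaronsonAmbainis2018, §6 (p. 26)] -/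
structure Spec where
  /-- number of active query wires -/
  Wv : List Bool → ℕ
  /-- number of active Hadamard layers -/
  Kv : List Bool → ℕ
  /-- the phase predicate: input, register content, layer -/
  Pf : List Bool → List Bool → ℕ → Bool
  /-- mode `W` (`00`), all registers zero: the output has length `Wv x` -/
  hW : ∀ x : List Bool,
    (P.Fn (dword x (fun _ => zeros (Wq P x.length)) (zeros (Ly P x.length)) (zeros 2) [false, false] ++
      CWrap.vg x.length)).length = Wv x
  /-- mode `K` (`10`), all registers zero: the output has length `Kv x` -/
  hK : ∀ x : List Bool,
    (P.Fn (dword x (fun _ => zeros (Wq P x.length)) (zeros (Ly P x.length)) (zeros 2) [true, false] ++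
      CWrap.vg x.length)).length = Kv x
  /-- mode `P` (`01`), layer register `1^j 0^{Ly-j}` (`1 ≤ j ≤ Ly`), copy code `c`: the output is
  empty iff the phase bit of layer `j` on the register of copy `c` is set -/
  hP : ∀ (x : List Bool) (q : ℕ → List Bool), (∀ c, (q c).length = Wq P x.length) →
    ∀ j, 1 ≤ j → j ≤ Ly P x.length → ∀ c, c < 3 →
      (P.Fn (dword x q (junary (Ly P x.length) j) (ccode c) [false, true] ++ CWrap.vg x.length) = [] ↔
        Pf x (q c) j = true)
  /-- mode `Z` (`11`), other registers zero: the output is empty iff no query register is zero -/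
  hZ : ∀ (x : List Bool) (q : ℕ → List Bool), (∀ c, (q c).length = Wq P x.length) →
    (P.Fn (dword x q (zeros (Ly P x.length)) (zeros 2) [true, true] ++ CWrap.vg x.length) = [] ↔
      ∀ c, c < 3 → q c ≠ zeros (Wq P x.length))

end Spec

/-! ### Data functions and clean assignments -/

section Clean

variable (x : List Bool)

local notation "N" => x.length

/-- **The data function**: the content of the data wires by position — input, query registers
(content `q c t`), layer register `[i < j]`, copy code of `c`, mode `(m0, m1)`. [folklore] -/
def dfun (q : ℕ → ℕ → Bool) (j c : ℕ) (m0 m1 : Bool) (i : ℕ) : Bool :=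
  if i < N then x.getD i false
  else if i < N + 3 * Wq P N then q ((i - N) / Wq P N) ((i - N) % Wq P N)
  else if i < N + 3 * Wq P N + Ly P N then decide (i - (N + 3 * Wq P N) < j)
  else if i = cw P N 0 then decide (c = 1)
  else if i = cw P N 1 then decide (c = 2)
  else if i = mw P N 0 then m0
  else if i = mw P N 1 then m1
  else false

/-- The register content of copy `c` as a list. [folklore] -/
def qlist (q : ℕ → ℕ → Bool) (c : ℕ) : List Bool := List.ofFn fun t : Fin (Wq P N) => q c t

/-- **Clean assignments**: data `F` below `D`, work wires of the block clear, wires above the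
block given by `top`. [folklore] -/
def cleanW (F top : ℕ → Bool) : ℕ → Bool :=
  fun i => if Wblk P N ≤ i then top i else if i < D P N then F i else false

/-- The data word of a data function, as a list of length `D`. [folklore] -/
def dlist (F : ℕ → Bool) : List Bool := List.ofFn fun i : Fin (D P N) => F i

/-- `|dlist F| = D`. [folklore] -/
@[simp] theorem length_dlist (F : ℕ → Bool) : (dlist P x F).length = D P N := by simp [dlist]

/-- `dlist F` read back. [folklore] -/
theorem getD_dlist (F : ℕ → Bool) (i : ℕ) : (dlist P x F).getD i false = if i < D P N then F i else false := by
  unfold dlist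
  split_ifs with h
  · rw [List.getD_eq_getElem _ _ (by simpa using h)]; simp
  · rw [List.getD_eq_default _ _ (by simpa using h)]

/-- Below the block a clean assignment is the string assignment of its data word. [folklore] -/
theorem cleanW_eq_ite_strW (F top : ℕ → Bool) :
    cleanW P x F top = fun i => if Wblk P N ≤ i then top i else strW (dlist P x F) i := by
  funext i
  simp only [cleanW, strW, getD_dlist]

/-- **The block lemma.** On a clean assignment the clean block leaves the data and the wires above
the block unchanged and writes the read-out of `P.Fn (data ++ vg N)` on the work wires.
[Bennett 1973, §2; Nielsen–Chuang 2010, §3.2.5] [cite: NielsenChuang2010, §3.2.5] -/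
theorem clEval_blkC_cleanW (F top : ℕ → Bool) :
    clEval (blkC P N) (cleanW P x F top) = fun i =>
      if Wblk P N ≤ i then top i else if i < D P N then F i
      else readOut P.e P.M (nT P N) (P.Fn (dlist P x F ++ CWrap.vg N)) i := by
  rw [cleanW_eq_ite_strW]
  have hframe : ∀ op ∈ blkC P N, ¬ (Wblk P N ≤ op.target) ∧ ∀ c ∈ op.controls, ¬ (Wblk P N ≤ c) := by
    intro op hop
    refine ⟨fun h => ?_, fun c hc h => ?_⟩
    · exact absurd (blkC_lt_Wblk P N op hop _ (by simp [wiresOf])) (not_lt.2 h)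
    · exact absurd (blkC_lt_Wblk P N op hop _ (by simp [wiresOf, hc])) (not_lt.2 h)
  rw [clEval_ite (fun i => Wblk P N ≤ i) (blkC P N) hframe]
  have hM := P.hM (dlist P x F ++ CWrap.vg N)
  have hlen : (dlist P x F ++ CWrap.vg N).length = (dlist P x F).length + (CWrap.vg N).length := List.length_append
  rw [hlen] at hM
  have hblk := clEval_cleanOps (e := P.e) (M := P.M) (dlist P x F) (CWrap.vg N) _ hM
  rw [length_dlist] at hblk
  funext i
  by_cases hi : Wblk P N ≤ i
  · simp [hi]
  · simp only [hi, if_false]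
    change clEval (cleanOps P.e P.M (D P N) (CWrap.vg N)) (strW (dlist P x F)) i = _
    rw [hblk]
    simp only [getD_dlist]
    by_cases hiD : i < D P N
    · simp [hiD]
    · simp only [hiD, if_false]; rfl

/-- **The emptiness wires after the block** read `[|out| ≤ j]` (represented cells `j < D`).
[folklore] -/
theorem clEval_blkC_cleanW_eW (F top : ℕ → Bool) {j : ℕ} (hj : j < D P N) :
    clEval (blkC P N) (cleanW P x F top) (eW P N j) =
      decide ((P.Fn (dlist P x F ++ CWrap.vg N)).length ≤ j) := by
  rw [clEval_blkC_cleanW]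
  have h1 : ¬ Wblk P N ≤ eW P N j := not_le.2 (eW_lt_Wblk P N hj)
  have h2 : ¬ eW P N j < D P N := not_lt.2 (D_le_eW P N j)
  simp only [h1, h2, if_false]
  have hM := P.hM (dlist P x F ++ CWrap.vg N)
  rw [eW, readOut_resW (lt_JJ_of_lt_D P N hj), CWrap.outBit_none_eq (e := P.e) (by simp) hM]

/-- After the block, the data wires are unchanged. [folklore] -/
theorem clEval_blkC_cleanW_of_lt_D (F top : ℕ → Bool) {i : ℕ} (hi : i < D P N) :
    clEval (blkC P N) (cleanW P x F top) i = F i := by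
  rw [clEval_blkC_cleanW]
  have h1 : ¬ Wblk P N ≤ i := not_le.2 (lt_of_lt_of_le hi (D_le_Wblk P N))
  simp [h1, hi]

/-- After the block, the wires above the block are unchanged. [folklore] -/
theorem clEval_blkC_cleanW_of_le (F top : ℕ → Bool) {i : ℕ} (hi : Wblk P N ≤ i) :
    clEval (blkC P N) (cleanW P x F top) i = top i := by
  rw [clEval_blkC_cleanW]; simp [hi]

/-- The block is an involution. [folklore] -/
theorem clEval_blkC_blkC (w : ℕ → Bool) : clEval (blkC P N) (clEval (blkC P N) w) = w :=
  clEval_cleanOps_cleanOps _ _ w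

/-- Updating a data wire of a clean assignment updates the data function. [folklore] -/
theorem update_cleanW_data (F top : ℕ → Bool) {p : ℕ} (hp : p < D P N) (b : Bool) :
    Function.update (cleanW P x F top) p b = cleanW P x (Function.update F p b) top := by
  funext i
  by_cases hip : i = p
  · subst hip
    have : ¬ Wblk P N ≤ i := not_le.2 (lt_of_lt_of_le hp (D_le_Wblk P N))
    simp [cleanW, this, hp]
  · rw [Function.update_of_ne hip]
    simp [cleanW, Function.update_of_ne hip]

/-- Updating a wire above the block of a clean assignment updates the top function. [folklore] -/
theorem update_cleanW_top (F top : ℕ → Bool) {p : ℕ} (hp : Wblk P N ≤ p) (b : Bool) :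
    Function.update (cleanW P x F top) p b = cleanW P x F (Function.update top p b) := by
  funext i
  by_cases hip : i = p
  · subst hip; simp [cleanW, hp]
  · rw [Function.update_of_ne hip]
    simp [cleanW, Function.update_of_ne hip]

/-- A `NOT` on a data wire. [folklore] -/
theorem eval_not_cleanW_data (F top : ℕ → Bool) {p : ℕ} (hp : p < D P N) :
    (ClOp.not p).eval (cleanW P x F top) = cleanW P x (Function.update F p (!F p)) top := by
  rw [ClOp.eval_not, update_cleanW_data P x F top hp]
  congr 1
  have : ¬ Wblk P N ≤ p := not_le.2 (lt_of_lt_of_le hp (D_le_Wblk P N))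
  simp [cleanW, this, hp]

/-- A `NOT` on a wire above the block. [folklore] -/
theorem eval_not_cleanW_top (F top : ℕ → Bool) {p : ℕ} (hp : Wblk P N ≤ p) :
    (ClOp.not p).eval (cleanW P x F top) = cleanW P x F (Function.update top p (!top p)) := by
  rw [ClOp.eval_not, update_cleanW_top P x F top hp]
  congr 1
  simp [cleanW, hp]

end Clean

/-! ### The data word of a data function -/

section DataWord

variable (x : List Bool)

local notation "N" => x.length

/-- `junary` read back. [folklore] -/
theorem getD_junary (L j r : ℕ) (hj : j ≤ L) (hr : r < L) : (junary L j).getD r false = decide (r < j) := by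
  unfold junary
  by_cases h : r < j
  · rw [List.getD_append _ _ _ _ (by simpa using h), List.getD_replicate _ h, decide_eq_true h]
  · rw [List.getD_append_right _ _ _ _ (by simpa using Nat.not_lt.1 h), List.length_replicate,
      List.getD_replicate _ (by omega), decide_eq_false h]

/-- `|junary L j| = L` for `j ≤ L`. [folklore] -/
@[simp] theorem length_junary (L j : ℕ) (hj : j ≤ L) : (junary L j).length = L := by
  simp [junary]; omega

/-- `|ccode c| = 2`. [folklore] -/
@[simp] theorem length_ccode (c : ℕ) : (ccode c).length = 2 := rfl

/-- `|qlist q c| = Wq`. [folklore] -/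
@[simp] theorem length_qlist (q : ℕ → ℕ → Bool) (c : ℕ) : (qlist P x q c).length = Wq P N := by simp [qlist]

/-- `qlist` read back. [folklore] -/
theorem getD_qlist (q : ℕ → ℕ → Bool) (c t : ℕ) (ht : t < Wq P N) : (qlist P x q c).getD t false = q c t := by
  unfold qlist; rw [List.getD_eq_getElem _ _ (by simpa using ht)]; simp

/-- Reading a concatenation. [folklore] -/
theorem getD_append_split (l r : List Bool) (i : ℕ) :
    (l ++ r).getD i false = if i < l.length then l.getD i false else r.getD (i - l.length) false := by
  split_ifs with h
  · exact List.getD_append _ _ _ _ h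
  · exact List.getD_append_right _ _ _ _ (Nat.not_lt.1 h)

/-- **The data word of a data function is `dword`.** [folklore] -/
theorem dlist_dfun (q : ℕ → ℕ → Bool) {j : ℕ} (hj : j ≤ Ly P N) (c : ℕ) (m0 m1 : Bool) :
    dlist P x (dfun P x q j c m0 m1) = dword x (qlist P x q) (junary (Ly P N) j) (ccode c) [m0, m1] := by
  have hLj : (junary (Ly P N) j).length = Ly P N := length_junary _ _ hj
  have hlen : (dword x (qlist P x q) (junary (Ly P N) j) (ccode c) [m0, m1]).length = D P N := by
    simp [dword, hLj, D]; ring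
  have hget : ∀ i, i < D P N → (dlist P x (dfun P x q j c m0 m1)).getD i false =
      (dword x (qlist P x q) (junary (Ly P N) j) (ccode c) [m0, m1]).getD i false := by
    intro i hi
    rw [getD_dlist, if_pos hi]
    simp only [dword, getD_append_split, length_qlist, hLj, length_ccode]
    unfold dfun
    by_cases c1 : i < N
    · simp only [c1, if_true]
    by_cases c4 : i < N + 3 * Wq P N
    · have hWp : 0 < Wq P N := by omega
      by_cases c2 : i - N < Wq P N
      · have hdiv : (i - N) / Wq P N = 0 := Nat.div_eq_of_lt c2
        have hmod : (i - N) % Wq P N = i - N := Nat.mod_eq_of_lt c2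
        simp only [c1, c4, c2, if_true, if_false, hdiv, hmod, getD_qlist P x q 0 _ c2]
      by_cases c3 : i - N - Wq P N < Wq P N
      · have hdiv : (i - N) / Wq P N = 1 := Nat.div_eq_of_lt_le (k := 1) (by omega) (by omega)
        have hmod : (i - N) % Wq P N = i - N - Wq P N := by
          rw [Nat.mod_eq_sub_mod (by omega), Nat.mod_eq_of_lt (by omega)]
        simp only [c1, c4, c2, c3, if_true, if_false, hdiv, hmod, getD_qlist P x q 1 _ c3]
      have c3' : i - N - Wq P N - Wq P N < Wq P N := by omega
      have hdiv : (i - N) / Wq P N = 2 := Nat.div_eq_of_lt_le (k := 2) (by omega) (by omega)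
      have hmod : (i - N) % Wq P N = i - N - Wq P N - Wq P N := by
        rw [Nat.mod_eq_sub_mod (by omega), Nat.mod_eq_sub_mod (by omega), Nat.mod_eq_of_lt (by omega)]
      simp only [c1, c4, c2, c3, c3', if_true, if_false, hdiv, hmod, getD_qlist P x q 2 _ c3']
    have c2 : ¬ i - N < Wq P N := by omega
    have c3 : ¬ i - N - Wq P N < Wq P N := by omega
    have c3' : ¬ i - N - Wq P N - Wq P N < Wq P N := by omega
    have e : i - N - Wq P N - Wq P N - Wq P N = i - (N + 3 * Wq P N) := by omega
    by_cases c5 : i < N + 3 * Wq P N + Ly P N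
    · have hr : i - (N + 3 * Wq P N) < Ly P N := by omega
      simp only [c1, c4, c2, c3, c3', c5, if_true, if_false, e, hr, getD_junary _ _ _ hj hr]
    have hr : ¬ i - (N + 3 * Wq P N) < Ly P N := by omega
    have e' : i - (N + 3 * Wq P N) - Ly P N = i - (N + 3 * Wq P N + Ly P N) := by omega
    have h02 : (0 : ℕ) < 2 := by norm_num
    have h12 : (1 : ℕ) < 2 := by norm_num
    by_cases c6 : i < N + 3 * Wq P N + Ly P N + 2
    · have : i = cw P N 0 ∨ i = cw P N 1 := by unfold cw; omega
      rcases this with rfl | rfl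
      · have e2 : cw P N 0 - (N + 3 * Wq P N + Ly P N) = 0 := by unfold cw; omega
        simp only [c1, c4, c2, c3, c3', c5, if_true, if_false, e, hr, e', e2, h02, ccode, List.getD_cons_zero]
      · have e2 : cw P N 1 - (N + 3 * Wq P N + Ly P N) = 1 := by unfold cw; omega
        have ne : cw P N 1 ≠ cw P N 0 := by unfold cw; omega
        simp only [c1, c4, c2, c3, c3', c5, if_true, if_false, e, hr, e', e2, h12, ne, ccode, List.getD_cons_zero,
          List.getD_cons_succ]
    have h2 : ¬ i - (N + 3 * Wq P N + Ly P N) < 2 := by omega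
    have e'' : i - (N + 3 * Wq P N + Ly P N) - 2 = i - (N + 3 * Wq P N + Ly P N + 2) := by omega
    have : i = mw P N 0 ∨ i = mw P N 1 := by unfold mw; unfold D at hi; omega
    rcases this with rfl | rfl
    · have e2 : mw P N 0 - (N + 3 * Wq P N + Ly P N + 2) = 0 := by unfold mw; omega
      have ne0 : mw P N 0 ≠ cw P N 0 := by unfold mw cw; omega
      have ne1 : mw P N 0 ≠ cw P N 1 := by unfold mw cw; omega
      simp only [c1, c4, c2, c3, c3', c5, if_true, if_false, e, hr, e', h2, e'', e2, ne0, ne1, List.getD_cons_zero]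
    · have e2 : mw P N 1 - (N + 3 * Wq P N + Ly P N + 2) = 1 := by unfold mw; omega
      have ne0 : mw P N 1 ≠ cw P N 0 := by unfold mw cw; omega
      have ne1 : mw P N 1 ≠ cw P N 1 := by unfold mw cw; omega
      have ne2 : mw P N 1 ≠ mw P N 0 := by unfold mw; omega
      simp only [c1, c4, c2, c3, c3', c5, if_true, if_false, e, hr, e', h2, e'', e2, ne0, ne1, ne2, List.getD_cons_zero,
        List.getD_cons_succ]
  apply List.ext_getElem
  · rw [length_dlist, hlen]
  · intro i h₁ h₂
    have := hget i (by simpa using h₁)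
    rwa [List.getD_eq_getElem _ _ h₁, List.getD_eq_getElem _ _ h₂] at this

end DataWord

/-! ### The mask stage -/

section Pre

variable (x : List Bool)

local notation "N" => x.length

/-- The all-zero query registers. [folklore] -/
def q0 : ℕ → ℕ → Bool := fun _ _ => false

/-- **The wires above the block by register**: wire mask `m`, layer mask `k`, control ancilla `a`,
answer flag `o`. [folklore] -/
def topF (m k : ℕ → Bool) (a o : Bool) (i : ℕ) : Bool :=
  if i < Wblk P N + Wq P N then m (i - Wblk P N)
  else if i < Wblk P N + Wq P N + Ly P N + 1 then k (i - Wblk P N - Wq P N)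
  else if i = aW P N then a else if i = oW P N then o else false

/-- The initial assignment `x 0 0 …` is clean, with zero registers. [folklore] -/
theorem strW_eq_cleanW :
    strW x = cleanW P x (dfun P x q0 0 0 false false) (topF P x (fun _ => false) (fun _ => false) false false) := by
  funext i
  simp only [strW, cleanW, topF, dfun, q0]
  have hD := D_le_Wblk P N
  by_cases h1 : Wblk P N ≤ i
  · rw [if_pos h1, List.getD_eq_default _ _ (by unfold D at hD; omega)]
    split_ifs <;> rfl
  rw [if_neg h1]
  by_cases h2 : i < D P N
  · rw [if_pos h2]
    by_cases h3 : i < N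
    · rw [if_pos h3]
    rw [if_neg h3, List.getD_eq_default _ _ (Nat.not_lt.1 h3)]
    split_ifs <;> rfl
  · rw [if_neg h2, List.getD_eq_default _ _ (by unfold D at h2; omega)]

/-- The copy pairs (emptiness wire of cell `t`, wire `base + t`), `t < K`. [folklore] -/
def cpairs (base K : ℕ) : List (ℕ × ℕ) := (List.range K).map fun t => (eW P N t, base + t)

/-- `pairsM` are copy pairs. [folklore] -/
theorem pairsM_eq : pairsM P N = cpairs P x (Wblk P N) (Wq P N) := rfl

/-- `pairsK` are copy pairs. [folklore] -/
theorem pairsK_eq : pairsK P N = cpairs P x (Wblk P N + Wq P N) (Ly P N + 1) := by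
  simp [pairsK, cpairs, KW, Nat.add_assoc]

/-- The targets of the copy pairs are pairwise distinct. [folklore] -/
theorem nodup_cpairs_snd (base K : ℕ) : ((cpairs P x base K).map Prod.snd).Nodup := by
  rw [cpairs, List.map_map]
  exact (List.nodup_range).map fun a b h => by simpa using h

/-- No target of the copy pairs is a source (targets above the block, sources inside).
[folklore] -/
theorem cpairs_target_ne_source {base K : ℕ} (hb : Wblk P N ≤ base) (hK : K ≤ D P N) :
    ∀ p ∈ cpairs P x base K, ∀ q ∈ cpairs P x base K, q.2 ≠ p.1 := by
  intro p hp q hq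
  simp only [cpairs, List.mem_map, List.mem_range] at hp hq
  obtain ⟨t, ht, rfl⟩ := hp
  obtain ⟨t', ht', rfl⟩ := hq
  have := eW_lt_Wblk P N (j := t) (by omega)
  change base + t' ≠ eW P N t; omega

/-- **The copy layer after the block**: the bits `[|out| ≤ t]`, `t < K`, are XORed onto the wires
`base + t`; the result is again "block applied to a clean assignment" (with the new top content),
ready for the uncomputation. [cite: NielsenChuang2010, §3.2.5] -/
theorem clEval_copy_blkC (F top : ℕ → Bool) {base K : ℕ} (hb : Wblk P N ≤ base) (hK : K ≤ D P N) :
    clEval (copyOps (cpairs P x base K)) (clEval (blkC P N) (cleanW P x F top)) =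
      clEval (blkC P N) (cleanW P x F fun i =>
        if base ≤ i ∧ i < base + K then
          (top i ^^ decide ((P.Fn (dlist P x F ++ CWrap.vg N)).length ≤ i - base)) else top i) := by
  funext i
  by_cases hi : base ≤ i ∧ i < base + K
  · obtain ⟨t, ht, rfl⟩ : ∃ t, t < K ∧ i = base + t := ⟨i - base, by omega, by omega⟩
    have hp : (eW P N t, base + t) ∈ cpairs P x base K := List.mem_map.2 ⟨t, List.mem_range.2 ht, rfl⟩
    rw [clEval_copyOps_target _ (nodup_cpairs_snd P x base K) (cpairs_target_ne_source P x hb hK) _ hp]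
    dsimp only
    rw [clEval_blkC_cleanW_eW P x _ _ (by omega), clEval_blkC_cleanW_of_le P x _ _ (by omega),
      clEval_blkC_cleanW_of_le P x _ _ (by omega), if_pos ⟨by omega, by omega⟩, Nat.add_sub_cancel_left]
  · rw [clEval_copyOps_of_ne _ _ (fun p hp h => ?_)]
    · by_cases hW : Wblk P N ≤ i
      · rw [clEval_blkC_cleanW_of_le P x _ _ hW, clEval_blkC_cleanW_of_le P x _ _ hW, if_neg hi]
      · rw [clEval_blkC_cleanW, clEval_blkC_cleanW]; simp [hW]
    · simp only [cpairs, List.mem_map, List.mem_range] at hp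
      obtain ⟨t, ht, rfl⟩ := hp
      exact hi ⟨by simp at h; omega, by simp at h; omega⟩

/-- A run of `NOT` gates on the wires `base + t`, `t < K`, above the block. [folklore] -/
theorem clEval_nots_cleanW (F top : ℕ → Bool) {base K : ℕ} (hb : Wblk P N ≤ base) :
    clEval ((List.range K).map fun t => ClOp.not (base + t)) (cleanW P x F top) =
      cleanW P x F fun i => if base ≤ i ∧ i < base + K then !top i else top i := by
  have hL : ((List.range K).map fun t => base + t).Nodup := (List.nodup_range).map fun a b h => by simpa using h
  have e : ((List.range K).map fun t => ClOp.not (base + t)) = ((List.range K).map fun t => base + t).map ClOp.not := by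
    rw [List.map_map]; rfl
  rw [e]
  funext i
  by_cases hi : base ≤ i ∧ i < base + K
  · have hmem : i ∈ (List.range K).map fun t => base + t := List.mem_map.2 ⟨i - base, List.mem_range.2 (by omega), by omega⟩
    rw [clEval_map_not_of_mem _ hL _ hmem]
    simp [cleanW, show Wblk P N ≤ i by omega, hi]
  · have hmem : i ∉ (List.range K).map fun t => base + t := by
      intro h; obtain ⟨t, ht, rfl⟩ := List.mem_map.1 h; exact hi ⟨by omega, by simp at ht; omega⟩
    rw [clEval_map_not_of_not_mem _ _ hmem]
    by_cases hW : Wblk P N ≤ i <;> simp [cleanW, hW, hi]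

/-- `notsM` is such a run. [folklore] -/
theorem notsM_eq : notsM P N = (List.range (Wq P N)).map fun t => ClOp.not (Wblk P N + t) := rfl

/-- `notsK` is such a run. [folklore] -/
theorem notsK_eq : notsK P N = (List.range (Ly P N + 1)).map fun t => ClOp.not (Wblk P N + Wq P N + t) := by
  simp [notsK, KW, Nat.add_assoc]

/-- Flipping the first mode bit of a data function. [folklore] -/
theorem update_dfun_mw0 (q : ℕ → ℕ → Bool) (j c : ℕ) (m0 m1 b : Bool) :
    Function.update (dfun P x q j c m0 m1) (mw P N 0) b = dfun P x q j c b m1 := by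
  funext i
  by_cases h : i = mw P N 0
  · subst h
    rw [Function.update_self]
    unfold dfun
    rw [if_neg (by unfold mw; omega), if_neg (by unfold mw; omega), if_neg (by unfold mw; omega),
      if_neg (by unfold mw cw; omega), if_neg (by unfold mw cw; omega), if_pos rfl]
  · rw [Function.update_of_ne h]
    unfold dfun
    simp only [h, if_false]

/-- Flipping the second mode bit of a data function. [folklore] -/
theorem update_dfun_mw1 (q : ℕ → ℕ → Bool) (j c : ℕ) (m0 m1 b : Bool) :
    Function.update (dfun P x q j c m0 m1) (mw P N 1) b = dfun P x q j c m0 b := by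
  funext i
  by_cases h : i = mw P N 1
  · subst h
    rw [Function.update_self]
    unfold dfun
    rw [if_neg (by unfold mw; omega), if_neg (by unfold mw; omega), if_neg (by unfold mw; omega),
      if_neg (by unfold mw cw; omega), if_neg (by unfold mw cw; omega), if_neg (by unfold mw; omega), if_pos rfl]
  · rw [Function.update_of_ne h]
    unfold dfun
    simp only [h, if_false]

/-- The first mode bit of a data function. [folklore] -/
theorem dfun_mw0 (q : ℕ → ℕ → Bool) (j c : ℕ) (m0 m1 : Bool) : dfun P x q j c m0 m1 (mw P N 0) = m0 := by
  have := congrFun (update_dfun_mw0 P x q j c m0 m1 m0) (mw P N 0)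
  rw [Function.update_self] at this
  exact this.symm

/-- The second mode bit of a data function. [folklore] -/
theorem dfun_mw1 (q : ℕ → ℕ → Bool) (j c : ℕ) (m0 m1 : Bool) : dfun P x q j c m0 m1 (mw P N 1) = m1 := by
  have := congrFun (update_dfun_mw1 P x q j c m0 m1 m1) (mw P N 1)
  rw [Function.update_self] at this
  exact this.symm

variable (S : Spec P)

/-- The zero registers as lists. [folklore] -/
theorem qlist_q0 : qlist P x q0 = fun _ => zeros (Wq P N) := by
  funext c; simp [qlist, q0, List.ofFn_const]

/-- `junary L 0 = 0^L`. [folklore] -/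
theorem junary_zero (L : ℕ) : junary L 0 = zeros L := by simp [junary]

/-- The length of the mode-`W` answer. [folklore] -/
theorem length_Fn_W : (P.Fn (dlist P x (dfun P x q0 0 0 false false) ++ CWrap.vg N)).length = S.Wv x := by
  rw [dlist_dfun P x q0 (Nat.zero_le _), qlist_q0, junary_zero]
  exact S.hW x

/-- The length of the mode-`K` answer. [folklore] -/
theorem length_Fn_K : (P.Fn (dlist P x (dfun P x q0 0 0 true false) ++ CWrap.vg N)).length = S.Kv x := by
  rw [dlist_dfun P x q0 (Nat.zero_le _), qlist_q0, junary_zero]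
  exact S.hK x

/-- Clean assignments only read the top content above the block. [folklore] -/
theorem cleanW_congr_top (F : ℕ → Bool) {top top' : ℕ → Bool} (h : ∀ i, Wblk P N ≤ i → top i = top' i) :
    cleanW P x F top = cleanW P x F top' := by
  funext i
  by_cases hi : Wblk P N ≤ i
  · simp [cleanW, hi, h i hi]
  · simp [cleanW, hi]

/-- **The top content after the mask stage**: the wire mask reads `[t < Wv x]`, the layer mask
`[j < Kv x]`, the ancilla and the flag are clear. [folklore] -/
def topPre : ℕ → Bool := topF P x (fun t => decide (t < S.Wv x)) (fun j => decide (j < S.Kv x)) false false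

/-- **The mask stage computes the masks** and restores everything else.
[cite: BernsteinVazirani1997, §8 (classical computation inside quantum machines)] -/
theorem clEval_preC : clEval (preC P N) (strW x) = cleanW P x (dfun P x q0 0 0 false false) (topPre P x S) := by
  have hb0 : Wblk P N ≤ Wblk P N := le_rfl
  have hWq : Wq P N ≤ D P N := by unfold D; omega
  have hLy : Ly P N + 1 ≤ D P N := by unfold D; omega
  rw [strW_eq_cleanW P x]
  simp only [preC, clEval_append, clEval_cons, clEval_nil]
  -- mode `W`: block, copy, block
  rw [pairsM_eq P x, clEval_copy_blkC P x _ _ hb0 hWq, clEval_blkC_blkC, length_Fn_W P x S]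
  -- mode `K`
  rw [eval_not_cleanW_data P x _ _ (mw_lt_D P N Nat.zero_lt_two), update_dfun_mw0, dfun_mw0]
  rw [pairsK_eq P x, clEval_copy_blkC P x _ _ (by omega) hLy, clEval_blkC_blkC]
  simp only [Bool.not_false]
  rw [length_Fn_K P x S, eval_not_cleanW_data P x _ _ (mw_lt_D P N Nat.zero_lt_two), update_dfun_mw0, dfun_mw0]
  simp only [Bool.not_true]
  -- negate the masks
  rw [notsM_eq, clEval_nots_cleanW P x _ _ hb0, notsK_eq, clEval_nots_cleanW P x _ _ (by omega)]
  refine cleanW_congr_top P x _ fun i hi => ?_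
  have haW : aW P N = Wblk P N + Wq P N + Ly P N + 1 := rfl
  have hoW : oW P N = Wblk P N + Wq P N + Ly P N + 2 := rfl
  simp only [topPre, topF]
  by_cases h1 : i < Wblk P N + Wq P N
  · have c2 : ¬ (Wblk P N + Wq P N ≤ i) := fun h => by omega
    simp [h1, hi, c2]
    by_cases hh : S.Wv x ≤ i - Wblk P N
    · simp [hh]
    · simp [hh]; omega
  by_cases h2 : i < Wblk P N + Wq P N + Ly P N + 1
  · have c2 : Wblk P N + Wq P N ≤ i := by omega
    have c3 : i < Wblk P N + Wq P N + (Ly P N + 1) := by omega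
    have e : i - (Wblk P N + Wq P N) = i - Wblk P N - Wq P N := by omega
    simp [h1, h2, hi, c2, c3, e]
    by_cases hh : S.Kv x ≤ i - Wblk P N - Wq P N
    · simp [hh]
    · simp [hh]; omega
  · have c3 : ¬ i < Wblk P N + Wq P N + (Ly P N + 1) := by omega
    simp [h1, h2, c3]

end Pre

/-! ### The phase macro and the zero test, classically -/

section Macro

variable (x : List Bool)

local notation "N" => x.length

/-- A run of `NOT` gates on distinct wires, applied twice, is the identity. [folklore] -/
theorem clEval_map_not_map_not (L : List ℕ) (hL : L.Nodup) (w : ℕ → Bool) :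
    clEval (L.map ClOp.not) (clEval (L.map ClOp.not) w) = w := by
  funext i
  by_cases hi : i ∈ L
  · rw [clEval_map_not_of_mem _ hL _ hi, clEval_map_not_of_mem _ hL _ hi, Bool.not_not]
  · rw [clEval_map_not_of_not_mem _ _ hi, clEval_map_not_of_not_mem _ _ hi]

/-- `xsJ j` as a run of `NOT` gates. [folklore] -/
theorem xsJ_eq (j : ℕ) : xsJ P N j = ((List.range j).map (jW P N)).map ClOp.not := by
  rw [xsJ, List.map_map]; rfl

/-- The wires of `xsJ j` are distinct. [folklore] -/
theorem nodup_xsJ_wires (j : ℕ) : ((List.range j).map (jW P N)).Nodup :=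
  (List.nodup_range).map fun a b h => by unfold jW at h; omega

/-- `xsJ` twice is the identity. [folklore] -/
theorem clEval_xsJ_xsJ (j : ℕ) (w : ℕ → Bool) : clEval (xsJ P N j) (clEval (xsJ P N j) w) = w := by
  rw [xsJ_eq]; exact clEval_map_not_map_not _ (nodup_xsJ_wires P x j) w

/-- `xsC` twice is the identity. [folklore] -/
theorem clEval_xsC_xsC (c : ℕ) (w : ℕ → Bool) : clEval (xsC P N c) (clEval (xsC P N c) w) = w := by
  unfold xsC
  split_ifs <;> simp [clEval, ClOp.eval_not]

/-- **The opening and the closing of the phase macro compose to the identity** (on every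
assignment: block, mode flip, copy code and layer writes are involutions).
[cite: NielsenChuang2010, §3.2.5 (uncomputation)] -/
theorem clEval_pOpen_pClose (j c : ℕ) (w : ℕ → Bool) :
    clEval (pClose P N j c) (clEval (pOpen P N j c) w) = w := by
  simp only [pOpen, pClose, clEval_append, clEval_cons, clEval_nil]
  rw [clEval_blkC_blkC]
  rw [show (ClOp.not (mw P N 1)).eval ((ClOp.not (mw P N 1)).eval (clEval (xsC P N c) (clEval (xsJ P N j) w))) =
      clEval (xsC P N c) (clEval (xsJ P N j) w) from ClOp.eval_involutive (op := ClOp.not (mw P N 1)) trivial _,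
    clEval_xsC_xsC, clEval_xsJ_xsJ]

/-- Writing `1^j` on the (clear) layer register of a data function. [folklore] -/
theorem clEval_xsJ_cleanW (q : ℕ → ℕ → Bool) {j : ℕ} (hj : j ≤ Ly P N) (c : ℕ) (m0 m1 : Bool) (top : ℕ → Bool) :
    clEval (xsJ P N j) (cleanW P x (dfun P x q 0 c m0 m1) top) = cleanW P x (dfun P x q j c m0 m1) top := by
  rw [xsJ_eq]
  funext i
  by_cases hi : i ∈ (List.range j).map (jW P N)
  · rw [clEval_map_not_of_mem _ (nodup_xsJ_wires P x j) _ hi]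
    obtain ⟨r, hr, rfl⟩ := List.mem_map.1 hi
    rw [List.mem_range] at hr
    have hlt : jW P N r < D P N := jW_lt_D P N (by omega)
    have hW : ¬ Wblk P N ≤ jW P N r := Nat.not_le.2 (lt_of_lt_of_le hlt (D_le_Wblk P N))
    simp only [cleanW, hW, if_false, hlt, if_true, dfun]
    rw [if_neg (by unfold jW; omega), if_neg (by unfold jW; omega), if_pos (by unfold jW; omega),
      if_neg (by unfold jW; omega), if_neg (by unfold jW; omega), if_pos (by unfold jW; omega)]
    simp only [Nat.not_lt_zero, decide_false, Bool.not_false]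
    rw [decide_eq_true (by unfold jW; omega)]
  · rw [clEval_map_not_of_not_mem _ _ hi]
    simp only [cleanW, dfun]
    by_cases hW : Wblk P N ≤ i
    · simp [hW]
    simp only [hW, if_false]
    by_cases hD : i < D P N
    swap
    · simp [hD]
    simp only [hD, if_true]
    by_cases h1 : i < N
    · simp [h1]
    by_cases h2 : i < N + 3 * Wq P N
    · simp [h1, h2]
    by_cases h3 : i < N + 3 * Wq P N + Ly P N
    · have hr : ¬ i - (N + 3 * Wq P N) < j := fun hr =>
        hi (List.mem_map.2 ⟨i - (N + 3 * Wq P N), List.mem_range.2 hr, by unfold jW; omega⟩)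
      simp [h1, h2, h3, hr]
    · simp [h1, h2, h3]

/-- Writing the code of copy `1`. [folklore] -/
theorem update_dfun_cw0 (q : ℕ → ℕ → Bool) (j : ℕ) (m0 m1 : Bool) :
    Function.update (dfun P x q j 0 m0 m1) (cw P N 0) true = dfun P x q j 1 m0 m1 := by
  funext i
  by_cases h : i = cw P N 0
  · subst h
    rw [Function.update_self]
    unfold dfun
    rw [if_neg (by unfold cw; omega), if_neg (by unfold cw; omega), if_neg (by unfold cw; omega), if_pos rfl]
    rfl
  · rw [Function.update_of_ne h]
    unfold dfun
    by_cases h' : i = cw P N 1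
    · subst h'
      have c1 : ¬ cw P N 1 < N := by unfold cw; omega
      have c2 : ¬ cw P N 1 < N + 3 * Wq P N := by unfold cw; omega
      have c3 : ¬ cw P N 1 < N + 3 * Wq P N + Ly P N := by unfold cw; omega
      simp only [c1, c2, c3, h, if_false, if_true]; decide
    · simp only [h, h', if_false]

/-- Writing the code of copy `2`. [folklore] -/
theorem update_dfun_cw1 (q : ℕ → ℕ → Bool) (j : ℕ) (m0 m1 : Bool) :
    Function.update (dfun P x q j 0 m0 m1) (cw P N 1) true = dfun P x q j 2 m0 m1 := by
  funext i
  by_cases h : i = cw P N 1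
  · subst h
    rw [Function.update_self]
    unfold dfun
    rw [if_neg (by unfold cw; omega), if_neg (by unfold cw; omega), if_neg (by unfold cw; omega),
      if_neg (by unfold cw; omega), if_pos rfl]
    rfl
  · rw [Function.update_of_ne h]
    unfold dfun
    by_cases h' : i = cw P N 0
    · subst h'
      have c1 : ¬ cw P N 0 < N := by unfold cw; omega
      have c2 : ¬ cw P N 0 < N + 3 * Wq P N := by unfold cw; omega
      have c3 : ¬ cw P N 0 < N + 3 * Wq P N + Ly P N := by unfold cw; omega
      simp only [c1, c2, c3, h, if_false, if_true]; decide
    · simp only [h, h', if_false]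

/-- The copy-code wires of a data function with copy `0` are clear. [folklore] -/
theorem dfun_cw_zero (q : ℕ → ℕ → Bool) (j : ℕ) (m0 m1 : Bool) (i : ℕ) (hi : i < 2) :
    dfun P x q j 0 m0 m1 (cw P N i) = false := by
  unfold dfun
  interval_cases i
  · rw [if_neg (by unfold cw; omega), if_neg (by unfold cw; omega), if_neg (by unfold cw; omega), if_pos rfl]; rfl
  · rw [if_neg (by unfold cw; omega), if_neg (by unfold cw; omega), if_neg (by unfold cw; omega),
      if_neg (by unfold cw; omega), if_pos rfl]; rfl

/-- Writing the code of copy `c < 3` on a clean assignment with copy code `0`. [folklore] -/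
theorem clEval_xsC_cleanW (q : ℕ → ℕ → Bool) (j : ℕ) {c : ℕ} (hc : c < 3) (m0 m1 : Bool) (top : ℕ → Bool) :
    clEval (xsC P N c) (cleanW P x (dfun P x q j 0 m0 m1) top) = cleanW P x (dfun P x q j c m0 m1) top := by
  unfold xsC
  interval_cases c
  · simp
  · simp only [if_true, clEval_cons, clEval_nil]
    rw [eval_not_cleanW_data P x _ _ (cw_lt_D P N Nat.zero_lt_two), dfun_cw_zero P x q j m0 m1 0 Nat.zero_lt_two,
      Bool.not_false, update_dfun_cw0]
  · simp only [show (2 : ℕ) ≠ 1 by decide, if_false, if_true, clEval_cons, clEval_nil]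
    rw [eval_not_cleanW_data P x _ _ (cw_lt_D P N Nat.one_lt_two), dfun_cw_zero P x q j m0 m1 1 Nat.one_lt_two,
      Bool.not_false, update_dfun_cw1]

/-- **The opening of the phase macro**: write layer `j`, copy `c` and mode `P`, then the block.
[folklore] -/
theorem clEval_pOpen (q : ℕ → ℕ → Bool) {j : ℕ} (hj : j ≤ Ly P N) {c : ℕ} (hc : c < 3) (top : ℕ → Bool) :
    clEval (pOpen P N j c) (cleanW P x (dfun P x q 0 0 false false) top) =
      clEval (blkC P N) (cleanW P x (dfun P x q j c false true) top) := by
  simp only [pOpen, clEval_append, clEval_cons, clEval_nil]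
  rw [clEval_xsJ_cleanW P x q hj, clEval_xsC_cleanW P x q j hc,
    eval_not_cleanW_data P x _ _ (mw_lt_D P N Nat.one_lt_two), update_dfun_mw1, dfun_mw1, Bool.not_false]

/-- **After the opening, the emptiness wire of cell `0` holds the phase bit** of layer `j` on the
register of copy `c` (`S.hP`). [cite: NielsenChuang2010, §6.1.1 (phase oracle from a bit oracle)] -/
theorem clEval_pOpen_eW (S : Spec P) (q : ℕ → ℕ → Bool) {j : ℕ} (hj1 : 1 ≤ j) (hj : j ≤ Ly P N) {c : ℕ} (hc : c < 3)
    (top : ℕ → Bool) :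
    clEval (pOpen P N j c) (cleanW P x (dfun P x q 0 0 false false) top) (eW P N 0) = S.Pf x (qlist P x q c) j := by
  rw [clEval_pOpen P x q hj hc, clEval_blkC_cleanW_eW P x _ _ (by unfold D; omega), dlist_dfun P x q hj]
  simp only [Nat.le_zero, List.length_eq_zero_iff]
  have h := S.hP x (qlist P x q) (fun c => length_qlist P x q c) j hj1 hj c hc
  by_cases hP : S.Pf x (qlist P x q c) j = true
  · rw [hP, decide_eq_true (h.2 hP)]
  · rw [Bool.not_eq_true] at hP
    rw [hP, decide_eq_false (fun h' => by rw [h.1 h'] at hP; exact Bool.false_ne_true hP.symm)]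

/-- **The zero test and read-out**: on a clean assignment with zero layer, copy and mode
registers and a clear flag, wire `0` finally holds `[some query register is zero]` (`S.hZ`).
[cite: AaronsonAmbainis2018, §6 (p. 26)] -/
theorem clEval_postC_zero (S : Spec P) (q : ℕ → ℕ → Bool) (top : ℕ → Bool) (ho : top (oW P N) = false) :
    clEval (postC P N) (cleanW P x (dfun P x q 0 0 false false) top) 0 = true ↔
      ∃ c, c < 3 ∧ qlist P x q c = zeros (Wq P N) := by
  have hoW : Wblk P N ≤ oW P N := by unfold oW; omega
  have ho0 : oW P N ≠ 0 := by unfold oW; omega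
  have e : postC P N = ([ClOp.not (mw P N 0), ClOp.not (mw P N 1)] ++ blkC P N ++
      [ClOp.cnot (eW P N 0) (oW P N), ClOp.not (oW P N)] ++ blkC P N ++ [ClOp.not (mw P N 0), ClOp.not (mw P N 1)]) ++
      [ClOp.cnot (oW P N) 0, ClOp.cnot 0 (oW P N), ClOp.cnot (oW P N) 0] := rfl
  rw [e, clEval_append, clEval_swap_apply _ _ ho0]
  simp only [clEval_append, clEval_cons, clEval_nil]
  -- the two mode flips after the second block and the second block do not touch the flag
  have hm1 : oW P N ≠ (ClOp.not (mw P N 1)).target := by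
    change oW P N ≠ mw P N 1; have := mw_lt_D P N Nat.one_lt_two; have := D_le_Wblk P N; omega
  have hm0 : oW P N ≠ (ClOp.not (mw P N 0)).target := by
    change oW P N ≠ mw P N 0; have := mw_lt_D P N Nat.zero_lt_two; have := D_le_Wblk P N; omega
  rw [ClOp.eval_apply_of_ne _ _ hm1, ClOp.eval_apply_of_ne _ _ hm0,
    clEval_apply_of_forall_target_ne _ _ (fun op hop h => by
      have := blkC_lt_Wblk P N op hop _ ((mem_wiresOf op op.target).2 (Or.inl rfl))
      rw [h] at this; unfold oW at this; omega)]
  rw [ClOp.eval_not, Function.update_self, ClOp.eval_cnot, Function.update_self]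
  -- the first block on mode `Z`
  rw [eval_not_cleanW_data P x _ _ (mw_lt_D P N Nat.zero_lt_two), update_dfun_mw0, dfun_mw0, Bool.not_false,
    eval_not_cleanW_data P x _ _ (mw_lt_D P N Nat.one_lt_two), update_dfun_mw1, dfun_mw1, Bool.not_false,
    clEval_blkC_cleanW_eW P x _ _ (by unfold D; omega), clEval_blkC_cleanW_of_le P x _ _ hoW, ho,
    dlist_dfun P x q (Nat.zero_le _), junary_zero, Bool.false_xor]
  simp only [Nat.le_zero, List.length_eq_zero_iff]
  have hc0 : ccode 0 = zeros 2 := rfl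
  rw [hc0]
  have h := S.hZ x (qlist P x q) (fun c => length_qlist P x q c)
  simp only [Bool.not_eq_true', decide_eq_false_iff_not, h]
  constructor
  · intro hn
    by_contra he
    exact hn fun c hc hq => he ⟨c, hc, hq⟩
  · rintro ⟨c, hc, hq⟩ hall
    exact hall c hc hq

end Macro

end PhaseQuery

end Literature.Computability.QuantumComplexity
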